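import Literature.Barriers.PneNP.GlobalFieldLayerEnergy
import Literature.Computability.Complexity.FourierDegreeAlgebra
import HarnessLib

/-!
# Barrier: subtracting low-degree Gram minorants does not restore an r-independent layer-energy bound
# (parity-masked sign features; the "Keevash–Lifshitz MODULO GRAM" step (KLG) of the r-uniform programme is false)

Fourth barrier of the cell pnp-psdrank (route `ChebyshevTracialDesign`, crux `TracialDecayExp20` = stmt-PneNP-19878). The third barrier
(`GlobalFieldLayerEnergy`: directional globalness of a whitened psd field does not bound its operator-norm layer energy) has as witness
the sign-feature field `w wᵀ`, `w = (χ_{S_1},…,χ_{S_r})` — a GRAM field of low degree `k`, which the cell's SIGN cell prices (bricks 23/90/94b,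
Grigoriev positivity). The prover's memo MEMO-20 §2(e) therefore proposed, as the residual input of the r-uniform line,
  (KLG) «a global whitened psd field splits as `A = BBᵀ + A'`, `BBᵀ ⪯ A` a psd Gram MINORANT of low degree, `A' ⪰ 0` with small operator
        layer energies (`≤ (Cτ log K)^{2κ}·N`)».
THIS FILE PROVES that (KLG) is false: no bound `c(k,d)·N`, `c` independent of `r`, survives the subtraction of an arbitrary psd Gram
minorant of degree `d`, for every `d` (all identities exact, on the cube `{0,1}^m`):
* `maskedField S P x = (1 + χ_P(x))·w(x)w(x)ᵀ`: the sign-feature field of a block family `S` (pairwise disjoint `k`-sets) MASKED by the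
  parity of a further block `P` (`|P| = ℓ`, disjoint from the `S_i`) — an amplitude in `{0,2}` of density `1/2` times the rank-one sign
  feature; `maskedField_posSemidef`, `smul_one_sub_maskedField_posSemidef` (`A ⪯ 2r·I`, so `K = 2r`).
* `sum_maskedField_piecewise`: PERFECT directional globalness `Σ_x A(x|_{J←σ}) = 2^m·I` for all `|J| < min(2k, ℓ)`; `sum_maskedField`.
* `layer_maskedField` (`2k < ℓ`): `A^{(2k)} = (wwᵀ)^{(2k)} = wwᵀ − I`; `sum_layer_sq_maskedField`: **`Σ_x (A^{(2k)})² = (r−1)·2^m·I`**.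
* **`gramMinorant_eq_zero`** (`2(d+k) < ℓ`): EVERY `B : {0,1}^m → ℝ^{r×m₀}` with entries of Fourier level `≤ d` and `B(x)B(x)ᵀ ⪯ A(x)`
  for all `x` is IDENTICALLY ZERO: rank one forces `B_{ic} = χ_{S_i}·g_c` with `g_c = χ_{S_{i₀}}B_{i₀c}` of level `≤ d+k` supported in
  `{χ_P = 1}` (`gramMinorant_entry_eq`), and a function of level `< ℓ/2` fixed by `χ_P` vanishes (`eq_zero_of_isLevelLE_of_mul_walsh_eq`:
  `ĝ(U) = ĝ(U ∆ P)`, `|U ∆ P| ≥ ℓ − |U|`). So the maximal low-degree psd Gram minorant is `0` and `A' = A` keeps the full energy, although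
  `A = 2·(½(1+χ_P)w)(½(1+χ_P)w)ᵀ` is itself Gram of degree `k + ℓ`: a high-degree {0,1} amplitude destroys low Gram degree and nothing else.
* `GramModuloLayerEnergy c` — the TECHNIQUE CLASS — and the BARRIER `constant_ge` (`c(k,d) ≥ r − 1` for all `r, k ≥ 1`, all `d`),
  `not_gramModuloLayerEnergy`.
* §5 `sum_maskedField_piecewise_apply`, **`sum_maskedField_piecewise_le`** — globalness at ALL depths `|J| < ℓ`: `Σ_x A(x|_{J←σ}) ⪯ 2^m(1+|J|/k)·I`. As `K = 2r`, bounds `(C(k,d)·log K)^{2k}` are refuted as well (`r − 1 > (C log 2r)^{2k}` for large `r`).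

technique_class: r-INDEPENDENT OPERATOR-NORM LAYER-ENERGY BOUNDS AFTER GRAM SUBTRACTION — «psd field `A` on the cube, `Σ_x A(x) = N·I`,
  directionally global with pins of size `< 2k` ⇒ there is a psd Gram minorant `BBᵀ ⪯ A`, entries of `B` of degree `≤ d`, with
  `Σ_x ((A − BBᵀ)^{(2k)})² ⪯ c·N·I`», `c = c(k,d)` (possibly polylogarithmic in `sup‖A‖`) NOT depending on `r`; formalised as
  `GramModuloLayerEnergy c`. [cite: KeevashLifshitz2023, Thm. 1.8 (the scalar statement: r = 1, B = 0)]
  [cite: BenAroyaRegevDeWolf2008, Thm. 1 (the matrix hypercontractivity that does hold, in normalised Schatten norms)]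
blocks: the decomposition route of cell memo MEMO-20 §1–§2(e): price a cut field by SIGN∞ (low-degree Gram minorant) ⊕ DOM (small relative
  layer energies, brick 87c) ⊕ JUNK (small trace) ⊕ pins, with (KLG) supplying «global ⇒ Gram + small energy». The masked field has NO Gram
  part of degree `< ℓ/2 − k`, layer-`2k` energy `(r−1)·N` (above every DOM threshold once `r ≫ n^k`), trace density `1/2` (not junk) and is
  unchanged by pins below `min(2k, ℓ)`: it lies in no cell, so the price list is INCOMPLETE and (KLG) cannot complete it. (The field is
  nevertheless harmless for the crux: per direction `v`, `vᵀA_Uv = (1+χ_P)(v·w)²` is a {0,2}-mask times a low-degree square, whose virtual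
  average inherits Grigoriev's sign when the mask is equidistributed on the level shells — an AMPLITUDE-MODULATED SIGN mechanism; MEMO-21 §2.)
because: `(1+χ_P)χ_{S_i}χ_{S_j} = χ_{S_i∪S_j} + χ_{P∪S_i∪S_j}`: restricting `< min(2k,ℓ)` coordinates leaves every term with `i ≠ j` or
  containing `P` unbiased; the level-`2k` part is `Σ_{i≠j}χ_{S_i∪S_j}E_{ij} = wwᵀ − I` (masked terms have degree `> 2k`), of square-sum
  `(r−1)·2^m·I` as in the third barrier; `BBᵀ ⪯ (1+χ_P)wwᵀ` forces `B = (χ_{S_i}g_c)` with `g_c` of level `< ℓ/2` supported in `{χ_P = 1}`,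
  hence `0`. [cite: ODonnell2014, Thm. 1.5, Fact 1.6 and §3.3 Prop. 3.21] [cite: BuhrmanCleveWigderson1998, §3] [cite: FranklWilson1981, §3]
evasions_known: (i) HIGH-PASS EQUIVALENCE (the evasion that prices THIS witness in the crux; kernel brick 95
  `Summit.PneNP.PneNP.Theorems.ChebyshevTracialDesignHighPassInvisible.value_le_of_lowDegree_add_highPass`): an exact design of degree `D`
  reads a cut field only through its entrywise harmonic layers of degree `≤ D`, up to `2·B_v·r·√P_D` (`abs_value_le_of_highPass`), so the
  cells should be stated MODULO HIGH HARMONICS — a non-psd equivalence: `(1+χ_P)wwᵀ = wwᵀ + χ_P·wwᵀ` and the second summand is indefinite but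
  purely of degree `≥ ℓ − 2k`; whenever that exceeds `D` (on the slice: whenever the mask parity has negligible harmonics of degree `≤ D + 2k`)
  the witness is priced as `½`·(the Gram field `wwᵀ`), and when `ℓ` is small the witness `2·(½(1+χ_P)w)(½(1+χ_P)w)ᵀ` is itself Gram of degree
  `k + ℓ` within the SIGN budget `c'` (brick 94b). What the barrier kills is the PSD-SUMMAND reading of the price list (Gram MINORANTS, (KLG)),
  not the list read modulo high-pass fields. (ii) AMPLITUDE-AWARE SIGN for masks WITH low harmonics: price `f·BBᵀ` (`f ≥ 0` a scalar mask, `B`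
  low degree) through the per-matching virtual average `Σ_U W(U,M) f(U) B_UB_Uᵀ` — `⪯ 0` exactly for `f ≡ 1` (Grigoriev), approximately when
  `f` is equidistributed on the level shells ("SOS-modulated non-tight-flatness"; `k = 0` is the cell's proved r = 1 rung); not formalised.
  (iii) TRACE normalisation and COUPLED mode bounds, as for the third barrier. (iv) Nothing is said against constants growing like `r`.
scope_caveats: CUBE with O'Donnell restrictions and EXACT globalness below `min(2k,ℓ)`; at depths `≥ 2k` the witness is still
  `(1 + |J|/k)`-global in psd order for `|J| < ℓ` (§5, FORMALISED: `sum_maskedField_piecewise_apply` — restricted mean `2^m(I + E_J)` with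
  `(E_J)_{ij} = ±[i ≠ j, S_i ∪ S_j ⊆ J]`; `sum_maskedField_piecewise_le` — `Σ_x A(x|_{J←σ}) ⪯ 2^m(1 + |J|/k)·I`), so all-depth globalness
  with `τ = 2` does not rescue (KLG). The cell's cut side is a SLICE (restricted characters have `o(1)` biases; not formalised). Nothing here
  bears on the crux itself, whose truth is consistent with the witness.
status: established (elementary character computation, this file).
-/

noncomputable section

open Finset Matrix
open scoped symmDiff

namespace Literature.Barriers.PneNP.GramMinorantLayerEnergy

open Literature.Computability.Complexity.LowDegree (cubeFourierCoeff sum_walsh_mul_walsh_index walsh_piecewise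
  sum_cubeFourierCoeff_mul_walsh walsh_mul_walsh cubeFourierCoeff_mul IsLevelLE isLevelLE_walsh)
open Literature.Probability.RandomGraphs.LowDegree (walsh sgn walsh_empty sgn_mul_self)
open Literature.Combinatorics.Optimization (walsh_mul_self)
open Literature.Barriers.PneNP.GlobalFieldLayerEnergy (walsh_union sum_walsh_eq_zero layer signVec sfField sfField_apply
  sfField_posSemidef signVec_dot sum_sfField_piecewise layer_sfField sum_layer_sq)

variable {m r : ℕ}

/-- `(a bᵀ) u = (b·u) a`. [folklore] -/
private theorem vecMulVec_mulVec_eq (a b u : Fin r → ℝ) : vecMulVec a b *ᵥ u = (b ⬝ᵥ u) • a := by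
  ext i
  simp only [mulVec, dotProduct, vecMulVec_apply, Pi.smul_apply, smul_eq_mul, Finset.sum_mul]
  exact sum_congr rfl fun j _ => by ring

/-- `e_iᵀ M e_i = M i i`. [folklore] -/
private theorem single_dotProduct_mulVec_single (M : Matrix (Fin r) (Fin r) ℝ) (i : Fin r) :
    Pi.single i (1 : ℝ) ⬝ᵥ M *ᵥ Pi.single i 1 = M i i := by
  rw [single_dotProduct, one_mul, mulVec, dotProduct_single, mul_one]

/-- `uᵀ (B Bᵀ) u = Σ_c ((Bᵀu)_c)²`. [folklore] -/
private theorem dotProduct_gram_mulVec {m₀ : ℕ} (B : Matrix (Fin r) (Fin m₀) ℝ) (u : Fin r → ℝ) :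
    u ⬝ᵥ (B * Bᵀ) *ᵥ u = ∑ c, (Bᵀ *ᵥ u) c ^ 2 := by
  rw [← mulVec_mulVec, dotProduct_mulVec, ← mulVec_transpose]
  simp_rw [dotProduct, sq]

/-! ### §1 The parity mask and the masked sign-feature field -/

/-- The parity mask `1 + χ_P(x) ∈ {0, 2}` of a block `P` (twice the indicator of `{x : χ_P(x) = 1}`, density `1/2`).
[cite: ODonnell2014, Thm. 1.5] -/
def parityMask (P : Finset (Fin m)) (x : Fin m → Bool) : ℝ := 1 + walsh P x

/-- A character takes the values `±1`. [cite: ODonnell2014, §1.2] -/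
theorem walsh_eq_one_or (P : Finset (Fin m)) (x : Fin m → Bool) : walsh P x = 1 ∨ walsh P x = -1 :=
  mul_self_eq_one_iff.1 (walsh_mul_self P x)

/-- The mask takes the values `0` and `2`. [cite: ODonnell2014, §1.2] -/
theorem parityMask_eq_zero_or_two (P : Finset (Fin m)) (x : Fin m → Bool) : parityMask P x = 2 ∨ parityMask P x = 0 := by
  unfold parityMask
  rcases walsh_eq_one_or P x with h | h
  · left; rw [h]; norm_num
  · right; rw [h]; norm_num

/-- The mask is nonnegative. [cite: ODonnell2014, §1.2] -/
theorem parityMask_nonneg (P : Finset (Fin m)) (x : Fin m → Bool) : 0 ≤ parityMask P x := by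
  rcases parityMask_eq_zero_or_two P x with h | h
  · rw [h]; norm_num
  · rw [h]

/-- The mask is at most `2`. [cite: ODonnell2014, §1.2] -/
theorem parityMask_le_two (P : Finset (Fin m)) (x : Fin m → Bool) : parityMask P x ≤ 2 := by
  rcases parityMask_eq_zero_or_two P x with h | h
  · rw [h]
  · rw [h]; norm_num

/-- THE PARITY-MASKED SIGN-FEATURE FIELD `A(x) = (1 + χ_P(x))·w(x)w(x)ᵀ`, `w = (χ_{S_1},…,χ_{S_r})`.
[cite: BuhrmanCleveWigderson1998, §3] [cite: FranklWilson1981, §3] -/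
def maskedField (S : Fin r → Finset (Fin m)) (P : Finset (Fin m)) (x : Fin m → Bool) : Matrix (Fin r) (Fin r) ℝ :=
  parityMask P x • sfField S x

/-- Entries of the masked field. [cite: BuhrmanCleveWigderson1998, §3] -/
theorem maskedField_apply (S : Fin r → Finset (Fin m)) (P : Finset (Fin m)) (x : Fin m → Bool) (i j : Fin r) :
    maskedField S P x i j = walsh (S i) x * walsh (S j) x + walsh P x * (walsh (S i) x * walsh (S j) x) := by
  rw [maskedField, Matrix.smul_apply, sfField_apply, smul_eq_mul, parityMask]; ring

/-- `A(x) ⪰ 0`. [cite: BuhrmanCleveWigderson1998, §3] -/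
theorem maskedField_posSemidef (S : Fin r → Finset (Fin m)) (P : Finset (Fin m)) (x : Fin m → Bool) :
    (maskedField S P x).PosSemidef :=
  (sfField_posSemidef S x).smul (parityMask_nonneg P x)

/-- `A(x) ⪯ 2r·I` (`‖w(x)‖² = r`, mask `≤ 2`): the witness is a bounded field with `K = 2r`. [cite: BuhrmanCleveWigderson1998, §3] -/
theorem smul_one_sub_maskedField_posSemidef (S : Fin r → Finset (Fin m)) (P : Finset (Fin m)) (x : Fin m → Bool) :
    (((2 * r : ℝ)) • (1 : Matrix (Fin r) (Fin r) ℝ) - maskedField S P x).PosSemidef := by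
  have h1 : ((2 * r : ℝ) • (1 : Matrix (Fin r) (Fin r) ℝ)).IsHermitian := by
    rw [Matrix.IsHermitian, conjTranspose_smul, star_trivial, conjTranspose_one]
  refine Matrix.PosSemidef.of_dotProduct_mulVec_nonneg (h1.sub (maskedField_posSemidef S P x).1) fun u => ?_
  have hform : star u ⬝ᵥ ((2 * r : ℝ) • (1 : Matrix (Fin r) (Fin r) ℝ) - maskedField S P x) *ᵥ u =
      (2 * r : ℝ) * (u ⬝ᵥ u) - parityMask P x * (signVec S x ⬝ᵥ u) ^ 2 := by
    rw [star_trivial, sub_mulVec, dotProduct_sub, smul_mulVec, one_mulVec, dotProduct_smul, smul_eq_mul, maskedField, sfField,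
      smul_mulVec, vecMulVec_mulVec_eq, dotProduct_smul, dotProduct_smul, smul_eq_mul, smul_eq_mul, dotProduct_comm u (signVec S x),
      sq]
  have hcs : (signVec S x ⬝ᵥ u) ^ 2 ≤ (u ⬝ᵥ u) * r := by
    have h := Finset.sum_mul_sq_le_sq_mul_sq (Finset.univ : Finset (Fin r)) (signVec S x) u
    have hw : ∑ i, signVec S x i ^ 2 = r := by
      have := signVec_dot S x
      simp only [dotProduct] at this
      simpa only [sq] using this
    have hu : ∑ i, u i ^ 2 = u ⬝ᵥ u := by simp only [dotProduct, sq]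
    rw [hw, hu] at h
    simpa only [dotProduct, mul_comm] using h
  rw [hform, sub_nonneg]
  calc parityMask P x * (signVec S x ⬝ᵥ u) ^ 2 ≤ 2 * ((u ⬝ᵥ u) * r) :=
        mul_le_mul (parityMask_le_two P x) hcs (sq_nonneg _) (by norm_num)
    _ = (2 * r : ℝ) * (u ⬝ᵥ u) := by ring

/-! A BLOCK FAMILY WITH MASK: `S : Fin r → Finset (Fin m)` pairwise disjoint `k`-sets, `P` a further block disjoint from every `S_i`;
carried as the hypotheses `hc`, `hd`, `hP` below. -/

variable {S : Fin r → Finset (Fin m)} {P : Finset (Fin m)} {k : ℕ}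

/-- `χ_P χ_{S_i} χ_{S_j} = χ_{P ∆ (S_i ∆ S_j)}`. [cite: ODonnell2014, Fact 1.6] -/
private theorem walsh_three (P A B : Finset (Fin m)) (x : Fin m → Bool) :
    walsh P x * (walsh A x * walsh B x) = walsh (P ∆ (A ∆ B)) x := by
  rw [walsh_mul_walsh, walsh_mul_walsh]

/-- `|P ∆ (S_i ∆ S_j)| ≥ |P|` when `P` is disjoint from `S_i`, `S_j`. [folklore] -/
private theorem card_le_card_symmDiff (hP : ∀ i, Disjoint P (S i)) (i j : Fin r) : P.card ≤ (P ∆ (S i ∆ S j)).card := by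
  refine card_le_card fun l hl => ?_
  rw [mem_symmDiff]
  refine Or.inl ⟨hl, fun hl' => ?_⟩
  rcases (mem_symmDiff.1 hl') with ⟨h1, -⟩ | ⟨h2, -⟩
  · exact disjoint_left.1 (hP i) hl h1
  · exact disjoint_left.1 (hP j) hl h2

/-- `Σ_x χ_V(x|_{J←σ}) = 0` when `|J| < |V|`. [cite: ODonnell2014, §3.3, Prop. 3.21] -/
private theorem sum_walsh_piecewise_eq_zero {V J : Finset (Fin m)} (σ : Fin m → Bool) (hJ : J.card < V.card) :
    ∑ x : Fin m → Bool, walsh V (J.piecewise σ x) = 0 := by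
  simp_rw [walsh_piecewise, ← Finset.mul_sum]
  have hne : V.filter (· ∉ J) ≠ ∅ := by
    intro h
    have hsub : V ⊆ J := fun l hl => by
      by_contra hlJ
      have : l ∈ V.filter (· ∉ J) := mem_filter.2 ⟨hl, hlJ⟩
      rw [h] at this
      exact notMem_empty l this
    exact absurd (card_le_card hsub) (by omega)
  rw [sum_walsh_eq_zero hne, mul_zero]

/-- **PERFECT DIRECTIONAL GLOBALNESS**: `Σ_x A(x|_{J←σ}) = 2^m·I` for every `|J| < 2k`, `|J| < |P|` and every `σ` — no pin set below that
depth changes the mean in any direction (`τ = 1`). [cite: ODonnell2014, §3.3 and Prop. 3.21] -/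
theorem sum_maskedField_piecewise (hc : ∀ i, (S i).card = k) (hd : ∀ i j, i ≠ j → Disjoint (S i) (S j)) (hP : ∀ i, Disjoint P (S i))
    (J : Finset (Fin m)) (σ : Fin m → Bool) (hJ : J.card < 2 * k) (hJP : J.card < P.card) :
    ∑ x : Fin m → Bool, maskedField S P (J.piecewise σ x) = ((2 : ℝ) ^ m) • (1 : Matrix (Fin r) (Fin r) ℝ) := by
  have h0 := sum_sfField_piecewise hc hd J σ hJ
  ext i j
  have h0ij := congrFun (congrFun h0 i) j
  rw [Matrix.sum_apply] at h0ij ⊢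
  simp_rw [sfField_apply] at h0ij
  simp_rw [maskedField_apply, sum_add_distrib, h0ij, walsh_three]
  rw [sum_walsh_piecewise_eq_zero σ (lt_of_lt_of_le hJP (card_le_card_symmDiff hP i j)), add_zero]

/-- **WHITENED NORMALISATION**: `Σ_x A(x) = 2^m·I` (`k ≥ 1`, `P ≠ ∅`). [cite: ODonnell2014, Thm. 1.5] -/
theorem sum_maskedField (hc : ∀ i, (S i).card = k) (hd : ∀ i j, i ≠ j → Disjoint (S i) (S j)) (hP : ∀ i, Disjoint P (S i))
    (hk : 1 ≤ k) (hP0 : 1 ≤ P.card) :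
    ∑ x : Fin m → Bool, maskedField S P x = ((2 : ℝ) ^ m) • (1 : Matrix (Fin r) (Fin r) ℝ) := by
  have h := sum_maskedField_piecewise hc hd hP ∅ (fun _ => false) (by rw [card_empty]; omega) (by rw [card_empty]; omega)
  simpa using h

/-! ### §2 The low layers ignore the mask -/

/-- `(g + h)^ = ĝ + ĥ`. [folklore] -/
private theorem cubeFourierCoeff_add' (g h : (Fin m → Bool) → ℝ) (T : Finset (Fin m)) :
    cubeFourierCoeff (fun x => g x + h x) T = cubeFourierCoeff g T + cubeFourierCoeff h T := by
  unfold cubeFourierCoeff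
  rw [← add_div, ← sum_add_distrib]
  congr 1
  exact sum_congr rfl fun x _ => by ring

/-- **THE LAYER-`2k` PART IS THAT OF THE UNMASKED FIELD** (`2k < |P|`): the masked terms `χ_{P ∪ S_i ∪ S_j}` have degree `> 2k`, so
`A^{(2k)} = (w wᵀ)^{(2k)} = w wᵀ − I`. [cite: ODonnell2014, Thm. 1.5 and Fact 1.6] -/
theorem layer_maskedField (hP : ∀ i, Disjoint P (S i)) (hkP : 2 * k < P.card) (x : Fin m → Bool) :
    layer (maskedField S P) (2 * k) x = layer (sfField S) (2 * k) x := by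
  ext i j
  simp only [layer, Matrix.of_apply]
  refine sum_congr rfl fun T hT => ?_
  have hTc := (mem_filter.1 hT).2
  congr 1
  have e : (fun y => maskedField S P y i j) = fun y => sfField S y i j + walsh (P ∆ (S i ∆ S j)) y := by
    funext y; rw [maskedField_apply, sfField_apply, walsh_three]
  rw [e, cubeFourierCoeff_add', Literature.Computability.Complexity.LowDegree.cubeFourierCoeff_walsh, if_neg, add_zero]
  intro hPT
  have := card_le_card_symmDiff hP i j
  rw [hPT, hTc] at this
  omega

/-- **THE LAYER ENERGY SURVIVES THE MASK**: `Σ_x (A^{(2k)}(x))² = (r−1)·2^m·I`. [cite: BuhrmanCleveWigderson1998, §3] [cite: ODonnell2014, Thm. 1.5] -/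
theorem sum_layer_sq_maskedField (hc : ∀ i, (S i).card = k) (hd : ∀ i j, i ≠ j → Disjoint (S i) (S j)) (hP : ∀ i, Disjoint P (S i))
    (hk : 1 ≤ k) (hkP : 2 * k < P.card) :
    ∑ x : Fin m → Bool, (layer (maskedField S P) (2 * k) x) ^ 2 = (((r : ℝ) - 1) * 2 ^ m) • (1 : Matrix (Fin r) (Fin r) ℝ) := by
  simp_rw [layer_maskedField hP hkP]
  exact sum_layer_sq hc hd hk

/-! ### §3 No low-degree Gram minorant -/

/-- A psd Gram matrix dominated by `0` vanishes: `B Bᵀ ⪯ 0 ⇒ B = 0`. [cite: HornJohnson2012, Thm. 4.2.2 (Rayleigh quotient)] -/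
private theorem eq_zero_of_gram_le_zero {m₀ : ℕ} (B : Matrix (Fin r) (Fin m₀) ℝ) (h : (0 - B * Bᵀ).PosSemidef) (i : Fin r) (c : Fin m₀) :
    B i c = 0 := by
  have hq := (Matrix.posSemidef_iff_dotProduct_mulVec.1 h).2 (Pi.single i 1)
  rw [zero_sub, neg_mulVec, dotProduct_neg, star_trivial, dotProduct_gram_mulVec] at hq
  have hrow : ∀ c', (Bᵀ *ᵥ Pi.single i (1 : ℝ)) c' = B i c' := fun c' => by
    rw [mulVec, dotProduct_single, mul_one, Matrix.transpose_apply]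
  simp_rw [hrow] at hq
  have h0 : ∑ c', B i c' ^ 2 = 0 := le_antisymm (by linarith) (sum_nonneg fun c' _ => sq_nonneg _)
  exact pow_eq_zero_iff (n := 2) (by norm_num) |>.1 ((sum_eq_zero_iff_of_nonneg fun c' _ => sq_nonneg _).1 h0 c (mem_univ _))

/-- **RANK ONE FORCES PARALLEL COLUMNS**: if `B(x)B(x)ᵀ ⪯ A(x) = (1+χ_P)wwᵀ` then `B_{ic}(x) = χ_{S_i}(x)·χ_{S_{i₀}}(x)·B_{i₀c}(x)` for all
`i, c` (where the mask vanishes both sides are `0`; where it is `2`, test against `u = w_i e_{i₀} − w_{i₀} e_i ⊥ w`).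
[cite: HornJohnson2012, Thm. 4.2.2 (Rayleigh quotient)] -/
theorem gramMinorant_entry_eq {m₀ : ℕ} (x : Fin m → Bool) (B : Matrix (Fin r) (Fin m₀) ℝ)
    (hmin : (maskedField S P x - B * Bᵀ).PosSemidef) (i₀ i : Fin r) (c : Fin m₀) :
    B i c = walsh (S i) x * walsh (S i₀) x * B i₀ c := by
  rcases parityMask_eq_zero_or_two P x with h2 | h0
  · -- mask = 2: test the domination against `u ⊥ w(x)`
    set u : Fin r → ℝ := Pi.single i₀ (walsh (S i) x) - Pi.single i (walsh (S i₀) x) with hu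
    have hq := (Matrix.posSemidef_iff_dotProduct_mulVec.1 hmin).2 u
    rw [star_trivial, sub_mulVec, dotProduct_sub] at hq
    -- `uᵀ A u = 2 (u·w)² = 0`
    have huw : signVec S x ⬝ᵥ u = 0 := by
      rw [hu, dotProduct_sub, dotProduct_single, dotProduct_single]
      simp only [signVec]; ring
    have hA : u ⬝ᵥ maskedField S P x *ᵥ u = 0 := by
      rw [maskedField, sfField, smul_mulVec, vecMulVec_mulVec_eq, huw, zero_smul, smul_zero, dotProduct_zero]
    -- `uᵀ B Bᵀ u = ‖Bᵀu‖²`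
    have hB : u ⬝ᵥ (B * Bᵀ) *ᵥ u = ∑ c', (Bᵀ *ᵥ u) c' ^ 2 := dotProduct_gram_mulVec B u
    rw [hA, hB] at hq
    have h0 : ∑ c', (Bᵀ *ᵥ u) c' ^ 2 = 0 := le_antisymm (by linarith) (sum_nonneg fun c' _ => sq_nonneg _)
    have hc0 : (Bᵀ *ᵥ u) c = 0 :=
      pow_eq_zero_iff (n := 2) (by norm_num) |>.1 ((sum_eq_zero_iff_of_nonneg fun c' _ => sq_nonneg _).1 h0 c (mem_univ _))
    rw [hu, mulVec_sub, Pi.sub_apply] at hc0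
    simp only [mulVec, dotProduct_single, Matrix.transpose_apply] at hc0
    -- `hc0 : B i₀ c * w_i − B i c * w_{i₀} = 0`
    have hw : walsh (S i₀) x * walsh (S i₀) x = 1 := walsh_mul_self _ _
    linear_combination (-(walsh (S i₀) x)) * hc0 + (-(B i c)) * hw
  · -- mask = 0: `B(x) = 0`
    have hA0 : maskedField S P x = 0 := by rw [maskedField, h0, zero_smul]
    rw [hA0] at hmin
    rw [eq_zero_of_gram_le_zero B hmin i c, eq_zero_of_gram_le_zero B hmin i₀ c, mul_zero]

/-- **A FUNCTION OF LEVEL `< |P|/2` SUPPORTED IN `{χ_P = 1}` IS ZERO**: if `g = g·χ_P` pointwise and `g` has Fourier level `≤ e` with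
`2e < |P|`, then `g ≡ 0` (`ĝ(U) = ĝ(U ∆ P)` and `|U ∆ P| ≥ |P| − |U|`). [cite: ODonnell2014, §1.4 (χ_S χ_T = χ_{S∆T}) and Thm. 1.1] -/
theorem eq_zero_of_isLevelLE_of_mul_walsh_eq {e : ℕ} {g : (Fin m → Bool) → ℝ} (hg : IsLevelLE e g) (heP : 2 * e < P.card)
    (hfix : ∀ x, g x * walsh P x = g x) (x : Fin m → Bool) : g x = 0 := by
  -- all Fourier coefficients vanish
  have hcoef : ∀ U : Finset (Fin m), cubeFourierCoeff g U = 0 := by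
    have hshift : ∀ U : Finset (Fin m), cubeFourierCoeff g U = cubeFourierCoeff g (P ∆ U) := by
      intro U
      have e1 : cubeFourierCoeff (fun y => g y * walsh P y) U = cubeFourierCoeff g U := by
        simp_rw [hfix]
      rw [← e1, cubeFourierCoeff_mul, Finset.sum_eq_single (P ∆ U)]
      · rw [Literature.Computability.Complexity.LowDegree.cubeFourierCoeff_walsh, symmDiff_symmDiff_cancel_right, if_pos rfl, mul_one]
      · intro T _ hT
        rw [Literature.Computability.Complexity.LowDegree.cubeFourierCoeff_walsh, if_neg, mul_zero]
        intro hPT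
        apply hT
        rw [hPT, symmDiff_symmDiff_cancel_right]
      · intro h; exact absurd (mem_univ _) h
    intro U
    by_cases hU : e < U.card
    · exact hg U hU
    · rw [hshift U]
      refine hg _ ?_
      have h1 : P.card ≤ (P \ U).card + U.card := card_le_card_sdiff_add_card
      have h2 : (P \ U).card ≤ (P ∆ U).card := card_le_card fun l hl => by
        rw [mem_symmDiff]; exact Or.inl (mem_sdiff.1 hl)
      omega
  rw [← sum_cubeFourierCoeff_mul_walsh g x]
  exact sum_eq_zero fun U _ => by rw [hcoef U, zero_mul]

/-- **NO LOW-DEGREE GRAM MINORANT.** If `2(d+k) < |P|`, every `B : {0,1}^m → ℝ^{r×m₀}` whose entries have Fourier level `≤ d` and with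
`B(x)B(x)ᵀ ⪯ A(x)` for all `x` is identically zero. [cite: ODonnell2014, §1.4 and §3.3] [cite: HornJohnson2012, Thm. 4.2.2] -/
theorem gramMinorant_eq_zero (hc : ∀ i, (S i).card = k) {d m₀ : ℕ} (hdP : 2 * (d + k) < P.card)
    (B : (Fin m → Bool) → Matrix (Fin r) (Fin m₀) ℝ) (hB : ∀ i c, IsLevelLE d (fun x => B x i c))
    (hmin : ∀ x, (maskedField S P x - B x * (B x)ᵀ).PosSemidef) (x : Fin m → Bool) : B x = 0 := by
  ext i c
  rcases Nat.eq_zero_or_pos r with hr | hr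
  · subst hr; exact Fin.elim0 i
  set i₀ : Fin r := ⟨0, hr⟩
  -- `g_c = χ_{S_{i₀}} · B_{i₀ c}` has level `≤ k + d`, is fixed by the mask, hence vanishes
  set g : (Fin m → Bool) → ℝ := fun y => walsh (S i₀) y * B y i₀ c with hgdef
  have hglev : IsLevelLE (k + d) g := (isLevelLE_walsh (S i₀) (hc i₀).le).mul (hB i₀ c)
  have hgfix : ∀ y, g y * walsh P y = g y := by
    intro y
    rcases walsh_eq_one_or P y with h1 | h1
    · rw [h1, mul_one]
    · -- mask = 0 at `y`: `B y = 0`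
      have h0 : parityMask P y = 0 := by rw [parityMask, h1]; norm_num
      have hA0 : maskedField S P y = 0 := by rw [maskedField, h0, zero_smul]
      have hmy := hmin y
      rw [hA0] at hmy
      rw [hgdef]; simp only
      rw [eq_zero_of_gram_le_zero (B y) hmy i₀ c, mul_zero, zero_mul]
  have hg0 : g x = 0 := eq_zero_of_isLevelLE_of_mul_walsh_eq hglev (by omega) hgfix x
  rw [Matrix.zero_apply, gramMinorant_entry_eq x (B x) (hmin x) i₀ i c, mul_assoc]
  rw [hgdef] at hg0
  simp only at hg0
  rw [hg0, mul_zero]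

/-! ### §4 The technique class and the barrier -/

/-- TECHNIQUE CLASS: **an r-independent layer-energy bound AFTER SUBTRACTING A LOW-DEGREE GRAM MINORANT** ("Keevash–Lifshitz modulo
Gram", cell memo MEMO-20 §2(e) (KLG)): a function `c : ℕ → ℕ → ℝ` of the layer index `k` and the Gram degree `d` (NOT of the dimension `r`)
such that every psd field `A : {0,1}^m → ℝ^{r×r}` with `Σ_x A(x) = 2^m·I`, perfectly directionally global below `2k`, admits a psd Gram
minorant `B(x)B(x)ᵀ ⪯ A(x)` with entries of `B` of Fourier level `≤ d` (any number `m₀` of columns; `B = 0` is allowed) whose remainder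
has layer-`2k` energy `Σ_x ((A − BBᵀ)^{(2k)})² ⪯ c(k,d)·2^m·I`. The third barrier's class `GlobalnessBoundsLayerEnergy` is the case
"`B = 0` forced". [cite: KeevashLifshitz2023, Thm. 1.8 (r = 1, B = 0)] [cite: BenAroyaRegevDeWolf2008, Thm. 1] -/
def GramModuloLayerEnergy (c : ℕ → ℕ → ℝ) : Prop :=
  ∀ (m r k d : ℕ), 1 ≤ k → ∀ A : (Fin m → Bool) → Matrix (Fin r) (Fin r) ℝ,
    (∀ x, (A x).PosSemidef) →
    (∑ x, A x = ((2 : ℝ) ^ m) • (1 : Matrix (Fin r) (Fin r) ℝ)) →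
    (∀ (J : Finset (Fin m)) (σ : Fin m → Bool), J.card < 2 * k →
        ∑ x, A (J.piecewise σ x) = ((2 : ℝ) ^ m) • (1 : Matrix (Fin r) (Fin r) ℝ)) →
    ∃ (m₀ : ℕ) (B : (Fin m → Bool) → Matrix (Fin r) (Fin m₀) ℝ),
      (∀ i c, IsLevelLE d (fun x => B x i c)) ∧
      (∀ x, (A x - B x * (B x)ᵀ).PosSemidef) ∧
      ((c k d * 2 ^ m) • (1 : Matrix (Fin r) (Fin r) ℝ) - ∑ x, (layer (fun y => A y - B y * (B y)ᵀ) (2 * k) x) ^ 2).PosSemidef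

/-- The standard block family on the first `r·k` of `r·k + ℓ` coordinates: `S_i = {i} × [k]`. [folklore] -/
def stdBlocks (r k ℓ : ℕ) : Fin r → Finset (Fin (r * k + ℓ)) :=
  fun i => (univ : Finset (Fin k)).map ⟨fun j => Fin.castAdd ℓ (finProdFinEquiv (i, j)), fun j j' h => by
    have := finProdFinEquiv.injective (Fin.castAdd_injective _ _ h)
    exact (Prod.mk.inj this).2⟩

/-- The standard mask block: the last `ℓ` of `r·k + ℓ` coordinates. [folklore] -/
def stdMask (r k ℓ : ℕ) : Finset (Fin (r * k + ℓ)) :=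
  (univ : Finset (Fin ℓ)).map ⟨fun j => Fin.natAdd (r * k) j, Fin.natAdd_injective _ _⟩

/-- The standard blocks have `k` elements each. [folklore] -/
private theorem stdBlocks_card (r k ℓ : ℕ) (i : Fin r) : (stdBlocks r k ℓ i).card = k := by
  rw [stdBlocks, card_map, card_univ, Fintype.card_fin]

/-- The standard mask has `ℓ` elements. [folklore] -/
private theorem stdMask_card (r k ℓ : ℕ) : (stdMask r k ℓ).card = ℓ := by
  rw [stdMask, card_map, card_univ, Fintype.card_fin]

/-- The standard blocks are pairwise disjoint. [folklore] -/
private theorem stdBlocks_disjoint (r k ℓ : ℕ) (i j : Fin r) (hij : i ≠ j) : Disjoint (stdBlocks r k ℓ i) (stdBlocks r k ℓ j) := by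
  rw [disjoint_left]
  intro l hl hl'
  rw [stdBlocks, mem_map] at hl hl'
  obtain ⟨a, -, ha⟩ := hl
  obtain ⟨b, -, hb⟩ := hl'
  have h := finProdFinEquiv.injective (Fin.castAdd_injective _ _ (ha.trans hb.symm))
  exact hij (Prod.mk.inj h).1

/-- The standard mask is disjoint from every standard block. [folklore] -/
private theorem stdMask_disjoint (r k ℓ : ℕ) (i : Fin r) : Disjoint (stdMask r k ℓ) (stdBlocks r k ℓ i) := by
  rw [disjoint_left]
  intro l hl hl'
  rw [stdMask, mem_map] at hl
  rw [stdBlocks, mem_map] at hl'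
  obtain ⟨a, -, ha⟩ := hl
  obtain ⟨b, -, hb⟩ := hl'
  have h1 : r * k ≤ (l : ℕ) := by rw [← ha]; simp
  have h2 : (l : ℕ) < r * k := by
    rw [← hb]
    have hb' := b.isLt
    have hi' := i.isLt
    simp only [Function.Embedding.coeFn_mk, Fin.val_castAdd, finProdFinEquiv_apply_val]
    nlinarith
  omega

/-- A scalar matrix `a·I` (`r ≥ 1`) is psd only if `a ≥ 0`. [cite: HornJohnson2012, Thm. 4.2.2 (Rayleigh quotient)] -/
private theorem nonneg_of_posSemidef_smul_one {a : ℝ} (hr : 1 ≤ r) (h : (a • (1 : Matrix (Fin r) (Fin r) ℝ)).PosSemidef) : 0 ≤ a := by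
  have hq := (Matrix.posSemidef_iff_dotProduct_mulVec.1 h).2 (Pi.single ⟨0, hr⟩ 1)
  rwa [smul_mulVec, one_mulVec, dotProduct_smul, star_trivial, single_dotProduct, one_mul, Pi.single_eq_same, smul_eq_mul,
    mul_one] at hq

/-- **BARRIER (quantitative form).** Any admissible constant is `≥ r − 1` for EVERY `r ≥ 1`, `k ≥ 1` and EVERY Gram degree `d`: the
parity-masked sign-feature field with `ℓ = 2(d+k)+1` is psd, whitened, perfectly global below `2k`, admits only the zero Gram minorant
of level `≤ d`, and has layer-`2k` energy `(r−1)·2^m·I`. [cite: BuhrmanCleveWigderson1998, §3] [cite: FranklWilson1981, §3]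
[cite: ODonnell2014, §1.4 and §3.3] -/
theorem constant_ge (c : ℕ → ℕ → ℝ) (h : GramModuloLayerEnergy c) {k : ℕ} (hk : 1 ≤ k) (d : ℕ) {r : ℕ} (hr : 1 ≤ r) :
    (r : ℝ) - 1 ≤ c k d := by
  set ℓ := 2 * (d + k) + 1 with hℓ
  have hc := stdBlocks_card r k ℓ
  have hd := stdBlocks_disjoint r k ℓ
  have hP := stdMask_disjoint r k ℓ
  have hPc := stdMask_card r k ℓ
  obtain ⟨m₀, B, hB, hmin, hpsd⟩ := h (r * k + ℓ) r k d hk (maskedField (stdBlocks r k ℓ) (stdMask r k ℓ))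
    (fun x => maskedField_posSemidef _ _ x) (sum_maskedField hc hd hP hk (by rw [hPc]; omega))
    (fun J σ hJ => sum_maskedField_piecewise hc hd hP J σ hJ (by rw [hPc]; omega))
  have hB0 : ∀ x, B x = 0 := gramMinorant_eq_zero hc (by rw [hPc]; omega) B hB hmin
  have e : (fun y => maskedField (stdBlocks r k ℓ) (stdMask r k ℓ) y - B y * (B y)ᵀ) = maskedField (stdBlocks r k ℓ) (stdMask r k ℓ) := by
    funext y; rw [hB0 y, Matrix.zero_mul, sub_zero]
  rw [e, sum_layer_sq_maskedField hc hd hP hk (by rw [hPc]; omega), ← sub_smul, ← sub_mul] at hpsd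
  have h0 := nonneg_of_posSemidef_smul_one hr hpsd
  have h2 : (0 : ℝ) < 2 ^ (r * k + ℓ) := by positivity
  have := (mul_nonneg_iff_of_pos_right h2).1 h0
  linarith

/-- **BARRIER (qualitative form): there is no r-independent layer-energy bound for global whitened psd fields modulo low-degree Gram
minorants** — `¬ GramModuloLayerEnergy c` for every `c`. The decomposition SIGN∞ ⊕ DOM ⊕ JUNK ⊕ pins of the cell's price list is
incomplete, and (KLG) cannot complete it. [cite: BuhrmanCleveWigderson1998, §3] [cite: KeevashLifshitz2023, Thm. 1.8] -/
theorem not_gramModuloLayerEnergy (c : ℕ → ℕ → ℝ) : ¬ GramModuloLayerEnergy c := by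
  intro h
  have h1 := constant_ge c h (k := 1) le_rfl 0 (r := ⌈|c 1 0|⌉₊ + 3) (by omega)
  have h2 : |c 1 0| ≤ (⌈|c 1 0|⌉₊ : ℝ) := Nat.le_ceil _
  have h3 : c 1 0 ≤ |c 1 0| := le_abs_self _
  push_cast at h1
  linarith

/-! ### §5 Globalness at ALL depths below the mask length (the scope caveat, formalised) -/

/-- **THE RESTRICTED MEAN AT ANY DEPTH `|J| < |P|`**: `Σ_x A(x|_{J←σ}) = 2^m·(I + E_J)` with `(E_J)_{ij} = ±[i ≠ j, S_i ∪ S_j ⊆ J]` (the sign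
being the restricted character's constant `Π_{l ∈ S_i ∪ S_j} χ(σ_l)`): only pairs of blocks ENTIRELY inside the pin set are biased — in
particular the diagonal (the density in every coordinate direction) is never changed. [cite: ODonnell2014, §3.3 and Prop. 3.21] -/
theorem sum_maskedField_piecewise_apply (hd : ∀ i j, i ≠ j → Disjoint (S i) (S j)) (hP : ∀ i, Disjoint P (S i))
    (J : Finset (Fin m)) (σ : Fin m → Bool) (hJP : J.card < P.card) (i j : Fin r) :
    (∑ x : Fin m → Bool, maskedField S P (J.piecewise σ x)) i j =
      if i = j then (2 : ℝ) ^ m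
      else if S i ∪ S j ⊆ J then (2 : ℝ) ^ m * ∏ l ∈ (S i ∪ S j).filter (· ∈ J), sgn (σ l) else 0 := by
  rw [Matrix.sum_apply]
  simp_rw [maskedField_apply, sum_add_distrib, walsh_three]
  rw [sum_walsh_piecewise_eq_zero σ (lt_of_lt_of_le hJP (card_le_card_symmDiff hP i j)), add_zero]
  by_cases hij : i = j
  · subst hij
    simp_rw [walsh_mul_self]
    rw [if_pos trivial, sum_const, card_univ, Fintype.card_fun, Fintype.card_fin, Fintype.card_bool, nsmul_eq_mul, mul_one]
    push_cast; ring
  · rw [if_neg hij]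
    simp_rw [← walsh_union (hd i j hij), walsh_piecewise, ← Finset.mul_sum]
    by_cases hsub : S i ∪ S j ⊆ J
    · rw [if_pos hsub]
      have hempty : (S i ∪ S j).filter (· ∉ J) = ∅ := by
        rw [Finset.filter_eq_empty_iff]; intro l hl hlJ; exact hlJ (hsub hl)
      rw [hempty]
      simp only [walsh_empty, sum_const, card_univ, Fintype.card_fun, Fintype.card_fin, Fintype.card_bool, nsmul_eq_mul, mul_one]
      push_cast; ring
    · rw [if_neg hsub]
      have hne : (S i ∪ S j).filter (· ∉ J) ≠ ∅ := by
        intro h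
        apply hsub
        intro l hl
        by_contra hlJ
        have : l ∈ (S i ∪ S j).filter (· ∉ J) := mem_filter.2 ⟨hl, hlJ⟩
        rw [h] at this
        exact notMem_empty l this
      rw [sum_walsh_eq_zero hne, mul_zero]

/-- The blocks inside a pin set `J` are at most `|J|/k` in number. [folklore] -/
private theorem card_blocks_subset_le (hc : ∀ i, (S i).card = k) (hd : ∀ i j, i ≠ j → Disjoint (S i) (S j)) (hk : 1 ≤ k)
    (J : Finset (Fin m)) : (((univ.filter fun i : Fin r => S i ⊆ J).card : ℝ)) ≤ (J.card : ℝ) / k := by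
  set B := univ.filter fun i : Fin r => S i ⊆ J with hB
  have hkpos : (0 : ℝ) < k := by exact_mod_cast hk
  rw [le_div_iff₀ hkpos]
  have h1 : (B.biUnion S).card = B.card * k := by
    rw [card_biUnion (fun i hi j hj hij => hd i j hij)]
    simp_rw [hc]
    rw [sum_const, smul_eq_mul]
  have h2 : (B.biUnion S).card ≤ J.card := card_le_card (biUnion_subset.2 fun i hi => (mem_filter.1 hi).2)
  have : B.card * k ≤ J.card := h1 ▸ h2
  exact_mod_cast this

/-- **ALL-DEPTH GLOBALNESS OF THE WITNESS** (the scope caveat of the header, formalised): for every pin set `J` with `|J| < |P|` (any size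
relative to `2k`) and every `σ`, `Σ_x A(x|_{J←σ}) ⪯ 2^m·(1 + |J|/k)·I` — the restricted mean exceeds the whitened mean `2^m·I` by at most
the factor `1 + |J|/k` in psd order (`τ = 2` in the Keller–Lifshitz sense at every depth below the mask length), so all-depth globalness
hypotheses do not rescue (KLG). [cite: ODonnell2014, §3.3 and Prop. 3.21] [cite: HornJohnson2012, Thm. 6.1.1 (Geršgorin discs)] -/
theorem sum_maskedField_piecewise_le (hc : ∀ i, (S i).card = k) (hd : ∀ i j, i ≠ j → Disjoint (S i) (S j)) (hP : ∀ i, Disjoint P (S i))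
    (hk : 1 ≤ k) (J : Finset (Fin m)) (σ : Fin m → Bool) (hJP : J.card < P.card) :
    ((((2 : ℝ) ^ m * (1 + (J.card : ℝ) / k)) • (1 : Matrix (Fin r) (Fin r) ℝ)) -
      ∑ x : Fin m → Bool, maskedField S P (J.piecewise σ x)).PosSemidef := by
  set Asum := ∑ x : Fin m → Bool, maskedField S P (J.piecewise σ x) with hAsum
  have happ := sum_maskedField_piecewise_apply hd hP J σ hJP
  -- Hermitian
  have hH : Asum.IsHermitian := by
    refine Matrix.IsHermitian.ext fun i j => ?_
    rw [star_trivial, hAsum, happ, happ]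
    by_cases hij : i = j
    · subst hij; rfl
    · rw [if_neg (Ne.symm hij), if_neg hij, union_comm]
  have h1H : (((2 : ℝ) ^ m * (1 + (J.card : ℝ) / k)) • (1 : Matrix (Fin r) (Fin r) ℝ)).IsHermitian := by
    rw [Matrix.IsHermitian, conjTranspose_smul, star_trivial, conjTranspose_one]
  refine Matrix.PosSemidef.of_dotProduct_mulVec_nonneg (h1H.sub hH) fun v => ?_
  rw [star_trivial, sub_mulVec, dotProduct_sub, smul_mulVec, one_mulVec, dotProduct_smul, smul_eq_mul, sub_nonneg]
  -- the quadratic form of `Asum`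
  set B := univ.filter fun i : Fin r => S i ⊆ J with hB
  have hquad : v ⬝ᵥ Asum *ᵥ v = ∑ i, ∑ j, v i * Asum i j * v j := by
    simp only [dotProduct, mulVec, Finset.mul_sum]
    exact sum_congr rfl fun i _ => sum_congr rfl fun j _ => by ring
  have hentry : ∀ i j, |Asum i j| ≤ (if i = j then (2 : ℝ) ^ m else if i ∈ B ∧ j ∈ B then (2 : ℝ) ^ m else 0) := by
    intro i j
    rw [hAsum, happ]
    by_cases hij : i = j
    · rw [if_pos hij, if_pos hij, abs_of_nonneg (by positivity)]
    · rw [if_neg hij, if_neg hij]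
      by_cases hsub : S i ∪ S j ⊆ J
      · have hiB : i ∈ B := mem_filter.2 ⟨mem_univ _, (subset_union_left).trans hsub⟩
        have hjB : j ∈ B := mem_filter.2 ⟨mem_univ _, (subset_union_right).trans hsub⟩
        rw [if_pos hsub, if_pos ⟨hiB, hjB⟩, abs_mul, abs_of_nonneg (by positivity : (0 : ℝ) ≤ 2 ^ m)]
        refine mul_le_of_le_one_right (by positivity) ?_
        rw [Finset.abs_prod]
        refine Finset.prod_le_one (fun l _ => abs_nonneg _) fun l _ => ?_
        rcases Bool.eq_false_or_eq_true (σ l) with h | h <;> simp [sgn, h]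
      · rw [if_neg hsub, abs_zero]; split_ifs <;> positivity
  -- bound the form: diagonal `2^m Σ v_i²` plus off-diagonal block part `≤ 2^m ((Σ_B |v_i|)² − Σ_B v_i²) ≤ 2^m (|B| − 1) Σ_B v_i²`
  have hvv : v ⬝ᵥ v = ∑ i, v i ^ 2 := by simp only [dotProduct, sq]
  have hform : v ⬝ᵥ Asum *ᵥ v ≤ (2 : ℝ) ^ m * ∑ i, v i ^ 2 + (2 : ℝ) ^ m * ((∑ i ∈ B, |v i|) ^ 2 - ∑ i ∈ B, v i ^ 2) := by
    rw [hquad]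
    calc ∑ i, ∑ j, v i * Asum i j * v j ≤ ∑ i, ∑ j, |v i| * (if i = j then (2 : ℝ) ^ m else if i ∈ B ∧ j ∈ B then (2 : ℝ) ^ m else 0) * |v j| := by
          refine sum_le_sum fun i _ => sum_le_sum fun j _ => ?_
          calc v i * Asum i j * v j ≤ |v i * Asum i j * v j| := le_abs_self _
            _ = |v i| * |Asum i j| * |v j| := by rw [abs_mul, abs_mul]
            _ ≤ |v i| * (if i = j then (2 : ℝ) ^ m else if i ∈ B ∧ j ∈ B then (2 : ℝ) ^ m else 0) * |v j| :=
                mul_le_mul_of_nonneg_right (mul_le_mul_of_nonneg_left (hentry i j) (abs_nonneg _)) (abs_nonneg _)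
      _ = (2 : ℝ) ^ m * ∑ i, v i ^ 2 + (2 : ℝ) ^ m * ((∑ i ∈ B, |v i|) ^ 2 - ∑ i ∈ B, v i ^ 2) := by
          -- split the double sum into the diagonal and the `B × B` off-diagonal part
          have e1 : ∀ i, ∑ j, |v i| * (if i = j then (2 : ℝ) ^ m else if i ∈ B ∧ j ∈ B then (2 : ℝ) ^ m else 0) * |v j| =
              (2 : ℝ) ^ m * v i ^ 2 + ∑ j, (if i ∈ B ∧ j ∈ B ∧ i ≠ j then (2 : ℝ) ^ m * (|v i| * |v j|) else 0) := by
            intro i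
            rw [← Finset.sum_erase_add _ _ (mem_univ i), if_pos rfl]
            have hdiag : |v i| * (2 : ℝ) ^ m * |v i| = (2 : ℝ) ^ m * v i ^ 2 := by
              rw [mul_comm (|v i|), mul_assoc, ← sq, sq_abs]
            rw [hdiag, add_comm]
            congr 1
            rw [← Finset.sum_erase_add _ _ (mem_univ i)]
            rw [if_neg (fun h => h.2.2 rfl), add_zero]
            refine sum_congr rfl fun j hj => ?_
            have hji : i ≠ j := fun h => (mem_erase.1 hj).1 h.symm
            rw [if_neg hji]
            by_cases hb : i ∈ B ∧ j ∈ B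
            · rw [if_pos hb, if_pos ⟨hb.1, hb.2, hji⟩]; ring
            · rw [if_neg hb, if_neg (fun h => hb ⟨h.1, h.2.1⟩)]; ring
          simp_rw [e1]
          rw [sum_add_distrib, ← mul_sum]
          congr 1
          -- the off-diagonal block sum equals `2^m((Σ_B |v|)² − Σ_B v²)`
          have e2 : ∑ i, ∑ j, (if i ∈ B ∧ j ∈ B ∧ i ≠ j then (2 : ℝ) ^ m * (|v i| * |v j|) else 0) =
              ∑ i ∈ B, ∑ j ∈ B, (if i ≠ j then (2 : ℝ) ^ m * (|v i| * |v j|) else 0) := by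
            rw [← sum_filter_add_sum_filter_not univ (fun i => i ∈ B)]
            have hz : ∑ i ∈ univ.filter (fun i => ¬ i ∈ B), ∑ j, (if i ∈ B ∧ j ∈ B ∧ i ≠ j then (2 : ℝ) ^ m * (|v i| * |v j|) else 0) = 0 :=
              sum_eq_zero fun i hi => sum_eq_zero fun j _ => by rw [if_neg (fun h => (mem_filter.1 hi).2 h.1)]
            rw [hz, add_zero, show univ.filter (fun i => i ∈ B) = B from by ext i; simp]
            refine sum_congr rfl fun i hi => ?_
            rw [← sum_filter_add_sum_filter_not univ (fun j => j ∈ B)]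
            have hz2 : ∑ j ∈ univ.filter (fun j => ¬ j ∈ B), (if i ∈ B ∧ j ∈ B ∧ i ≠ j then (2 : ℝ) ^ m * (|v i| * |v j|) else 0) = 0 :=
              sum_eq_zero fun j hj => by rw [if_neg (fun h => (mem_filter.1 hj).2 h.2.1)]
            rw [hz2, add_zero, show univ.filter (fun j => j ∈ B) = B from by ext j; simp]
            refine sum_congr rfl fun j hj => ?_
            by_cases hij : i ≠ j
            · rw [if_pos ⟨hi, hj, hij⟩, if_pos hij]
            · rw [if_neg (fun h => hij h.2.2), if_neg hij]
          rw [e2, sq, sum_mul_sum]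
          rw [show ∑ i ∈ B, ∑ j ∈ B, |v i| * |v j| - ∑ i ∈ B, v i ^ 2 = ∑ i ∈ B, ∑ j ∈ B, (if i ≠ j then |v i| * |v j| else 0) from ?_]
          · rw [mul_sum]; refine sum_congr rfl fun i _ => ?_
            rw [mul_sum]; refine sum_congr rfl fun j _ => ?_
            split_ifs <;> simp
          · rw [← sum_sub_distrib]
            have : ∀ i ∈ B, ∑ j ∈ B, |v i| * |v j| - v i ^ 2 = ∑ j ∈ B, (if i ≠ j then |v i| * |v j| else 0) := by
              intro i hi
              rw [← Finset.sum_erase_add _ _ hi, ← Finset.sum_erase_add B _ hi, if_neg (not_not.2 rfl), add_zero, ← sq_abs, sq]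
              rw [add_sub_cancel_right]
              exact sum_congr rfl fun j hj => by rw [if_pos (fun h => (mem_erase.1 hj).1 h.symm)]
            exact sum_congr rfl this
  -- Cauchy–Schwarz on `B`: `(Σ_B |v_i|)² ≤ |B| Σ_B v_i²`
  have hCS : (∑ i ∈ B, |v i|) ^ 2 ≤ (B.card : ℝ) * ∑ i ∈ B, v i ^ 2 := by
    have h := Finset.sum_mul_sq_le_sq_mul_sq B (fun _ => (1 : ℝ)) (fun i => |v i|)
    simp only [one_mul, one_pow, sum_const, sq_abs] at h
    simpa using h
  have hBle : (B.card : ℝ) ≤ (J.card : ℝ) / k := card_blocks_subset_le hc hd hk J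
  have hBv : ∑ i ∈ B, v i ^ 2 ≤ ∑ i, v i ^ 2 := sum_le_sum_of_subset_of_nonneg (subset_univ B) fun i _ _ => sq_nonneg _
  have hBv0 : 0 ≤ ∑ i ∈ B, v i ^ 2 := sum_nonneg fun i _ => sq_nonneg _
  have h2m : (0 : ℝ) ≤ 2 ^ m := by positivity
  rw [hvv]
  calc v ⬝ᵥ Asum *ᵥ v ≤ (2 : ℝ) ^ m * ∑ i, v i ^ 2 + (2 : ℝ) ^ m * ((∑ i ∈ B, |v i|) ^ 2 - ∑ i ∈ B, v i ^ 2) := hform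
    _ ≤ (2 : ℝ) ^ m * ∑ i, v i ^ 2 + (2 : ℝ) ^ m * (((J.card : ℝ) / k) * ∑ i, v i ^ 2) := by
        have : (∑ i ∈ B, |v i|) ^ 2 - ∑ i ∈ B, v i ^ 2 ≤ ((J.card : ℝ) / k) * ∑ i, v i ^ 2 := by
          have hk0 : (0 : ℝ) ≤ (J.card : ℝ) / k := by positivity
          nlinarith [hCS, hBle, hBv, hBv0, mul_le_mul hBle hBv hBv0 hk0]
        nlinarith [this, h2m]
    _ = (2 : ℝ) ^ m * (1 + (J.card : ℝ) / k) * ∑ i, v i ^ 2 := by ring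

end Literature.Barriers.PneNP.GramMinorantLayerEnergy

end
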